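import Mathlib
import HarnessLib
import HarnessLib.Audit
import Summits.MatrixMultiplication.Statement
import Literature.Computability.AlgebraicComplexity.MatrixMultiplicationExponent
import Literature.Computability.AlgebraicComplexity.SchoenhageTau
import Literature.Computability.AlgebraicComplexity.GroupAlgebraTensor
import Literature.Computability.AlgebraicComplexity.CohnUmansTPP
import Literature.RepresentationTheory.FiniteGroups.CharacterDegrees
import Literature.RepresentationTheory.FiniteGroups.WedderburnBlocks
import HarnessLib.Audit.Status.Attr

/-!
Route: ReesMunnRealization

DORMANT since 2026-08-22T08:21:29Z (reconciler: no traction for 5.2 d (last activity statement-grounded at 2026-08-17T02:55:19Z); parked, not closed — `ledger route dormant route-MatrixMultiplication-ReesMunnRealization --off` to reacti) — unstaffed, not closed; items shared with open routes are served there. `ledger route dormant <id> --off` reactivates.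

# Route ReesMunnRealization — strict Cohn–Umans realizations in Rees–Munn semigroup bases give
constant-loss block restrictions of matrix multiplication

X (CONSTANT-LOSS BLOCK RESTRICTIONS, the stripped form of card rees-munn-monomial-algebras C1, as
the refuter's costume check
asked): there is c > 0 such that for every t some matrix multiplication tensor ⟨a,b,e⟩ RESTRICTS
(one shot, no powers, no
degeneration) to a direct sum ⊕_i ⟨d_i,d_i,d_i⟩ with packing (abe)^(1/3) ≥ c^(1/3)·(Σ d_i²)^(1/2)
and every block small,
t·d_i² ≤ Σ_j d_j² ("at least t comparable blocks"). X → ω(ℂ) = 2 by the Cohn–Umans block inequality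
(abe)^(ω/3) ≤ Σ d_i^ω ≤
(D/t)^((ω−2)/2)·D, D = Σ d_i², which for fixed c and t → ∞ forces ω ≤ 2. The route's SOURCE of such
restrictions is the card's
mechanism: strict realizations (Cohn–Umans 2013 Def 8, structure constants 0/1) of ⟨a,b,e⟩ in
contracted semigroup algebras
ℂ₀[S] of finite regular semigroups — Rees matrix semigroups M⁰(G;n,n;P) with sandwich matrix P (host
tensor ≤ ⟨n,n,n⟩ ⊗
T_ℂ[G] = ⊕_χ ⟨n·d_χ⟩, |G| equal blocks of size n for abelian G) and rook-monoid ideals (J-order rank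
drop) — where every
realization is strict for free. Realises card rees-munn-monomial-algebras (spine; its F1–F4 = the
support items, C1 =
AbelianReesFamily/RookIdealGain feeding X, C2 = ReesBeatsSumOfCubes, C3 = FibrePacking).
Lean: `∃ c : ℝ, 0 < c ∧ ∀ t : ℕ, ∃ (p : ℕ) (d : Fin p → ℕ) (a b e : ℕ), 0 < p ∧ (∀ i, 1 ≤ d i) ∧ 1 ≤
a * b * e ∧ Literature.Computability.AlgebraicComplexity.TensorRestrictsTo
(Literature.Computability.AlgebraicComplexity.matMulDirectSum ℂ d d d)
(Literature.Computability.AlgebraicComplexity.matMulTensor ℂ a b e) ∧ c * (∑ i, (d i : ℝ) ^ 2) ^ ((3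
: ℝ) / 2) ≤ ((a * b * e : ℕ) : ℝ) ∧ ∀ i, (t : ℝ) * (d i : ℝ) ^ 2 ≤ ∑ j, (d j : ℝ) ^ 2`

## Assembly
BlockRestrictionBound → BlockRestrictionFamily → ω(ℂ) = 2, elementary real analysis (sorry-free
shape checked in Sketch.lean,
proof sketched): if ω > 2 put η = ω − 2; for the host of parameter t ≥ 1, D = Σ d_i² ≥ 1,
(abe)^(ω/3) ≥ (c·D^(3/2))^(ω/3) =
c^(ω/3)·D^(1+η/2) while Σ d_i^ω = Σ d_i²·(d_i²)^(η/2) ≤ D·(D/t)^(η/2); so c^(ω/3) ≤ t^(−η/2) for all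
t, absurd as t → ∞; with
omega_two_le (FlatteningBound) ω = 2, i.e. MatrixMultiplication (MatrixMultiplication_iff). The
cruxes feed the target through
the support glue: AbelianReesFamily → BlockRestrictionFamily (AbelianReesGivesTarget); a
RookIdealGain/ReesBeatsSumOfCubes
instance is a finite certificate of ω < 3 through a semigroup and the seed for a family;
FibrePacking closes the abelian
sandwich sub-line (it implies abe ≤ n³|G| for every abelian Rees host).

Rationale: WHY THIS LINE. Cohn–Umans 2013 (arXiv:1207.6528 §4.1, Def 8, Prop 9–10) already isolate what the
group-theoretic method uses — a basis in which
⟨ℓ,m,n⟩ embeds by three injections with an iff-condition on structure constants — and remark (p. 9)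
that they "know of few
interesting examples of strict realization beyond group algebras"; semigroup theory
(Munn–Ponizovskii, Clifford–Preston Ch. 5,
Steinberg doi:10.1007/978-3-319-43932-7 Ch. 5, Solomon doi:10.1016/s0021-8693(02)00004-2) classifies
exactly the finite-
dimensional algebras with a MONOMIAL 0/1 basis and a computable Wedderburn decomposition: contracted
algebras of regular
semigroups, ℂ₀[M⁰(G;n,n;P)] ↪ M_n(ℂ[G]) and ℂ[I_m] ≅ ⊕_s M_C(m,s)(ℂ[S_s]). Imported: semigroup
structure theory (Green's
relations, sandwich matrices, the J-order) and design theory (0/G-valued sandwich matrices,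
prescribed-intersection set
systems) as a new supply of strict realizations; the engine (CohnUmans2003 Thm 4.1 = CKSU Thm 1.8,
PROVED in the cone as
rpow_omega_le_sum_blockDegrees_rpow; Schönhage τ, asymptoticSumInequality_rank) is unchanged and the
whole frame is provable
now. What it does that route GroupTheoreticSTPP and the negatives index (empty) do not: leaves
groups — the group packing
theorems (BlasiakCohnGrochowPrattUmans2023 Thm 3.2/Cor 3.5, unitary Fourier analysis; CohnUmans2003
Lemma 3.1 for abelian
hosts) do not cover twisted sandwich products, and this session's fibre reduction shows precisely
where gain can live (no full
fibres, no identity sandwich: BrandtNoGain) — so the first bit (FibrePacking vs AbelianReesFamily)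
is a clean, new,
decidable-in-small-cases packing question.

RANKED CRUXES. #0 BlockRestrictionFamily (target; DERIVED since rev 3 — no longer a hypothesis of
`closes`: Step 1 of `closes` and the glue item BlockRestrictionFamilyOfFibreDesigns (proof attached)
derive it from FibreDesignFamily + FibreLift + DegreeLeIndexAbelian + ReesHostBlocks +
RealizationRestricts) — X: ∃ c > 0 ∀ t ∃ block sizes d_1..d_p ≥ 1 (p ≥ 1) and a,b,e with abe ≥ 1,
⟨a,b,e⟩ ≤ ⊕_i ⟨d_i,d_i,d_i⟩ (TensorRestrictsTo), c·(Σ d_i²)^(3/2) ≤ abe and t·d_i² ≤ Σ_j d_j² for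
all i. (why it might fail: A priori STRONGER than ω = 2 (ω = 2 only yields loss c → 0 like
m^(−o(1))); every known restriction family (Strassen-type ⟨kN⟩ ≤ R(⟨k⟩)⊙⟨N⟩, CKSU group hosts) has c
→ 0 as t → ∞; a packing-gap theorem for restrictions into ⊕⟨d_i⟩ with many comparable blocks would
kill it.) [arXiv:1207.6528, CohnKleinbergSzegedyUmans2005, CohnUmans2003,
BlasiakCohnGrochowPrattUmans2023]
#2 FibreDesignFamily (crux, THE DECIDING LEAF since 2026-08-17; typed decomposition of X by the
crux-strategist) — ∃ c > 0 ∀ t ∃ finite group G with an ABELIAN SUBGROUP A of small index, t·[G:A]²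
≤ |G|, n ≥ 1, sandwich P : [n]×[n] → G ∪ {0} and a strict realization (φ,ψ,χ) of ⟨a,b,e⟩ in the
P-twisted FIBRE tensor F_P((λ,g),(ι,h)) = g·P[λ,ι]·h (φ,ψ into [n]×G, χ into G) with c·n·|G|^(3/2) ≤
abe (flattenings give abe ≤ n|G|^(3/2): constant loss). A = G is ¬FibrePacking-with-growth
(AbelianReesFamily’s fibrewise form); admitted non-abelian hosts: generalized dihedral / Frobenius
A⋊C_k (degrees ≤ k), Heisenberg-type. FibreLift (copy the fibre design into all n²
(row,column)-label fibres: a realization of ⟨na,b,ne⟩ in M⁰(G;n,n;P), PROVED as candidate) +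
ReesHostBlocks + RealizationRestricts + DegreeLeIndexAbelian (d_χ ≤ [G:A], Isaacs Problem 2.9(b),
proved in CongruenceTowerPacking) give X with blocks n·d_χ, t·(n d_χ)² ≤ n²·t[G:A]² ≤ n²|G| (glue
blockRestrictionFamily_of_subs, sorry-free, Cruxes/BlockRestrictionFamily/Lines/decomposition.lean).
First line tried and DEAD (Lines/perfect_cell_powers.lean, sorry-free): ONE perfect twisted cell ⊗
powers ⟹ the family with c = 1 (composition proved), but no perfect cell exists (a surjective χ
forces P to vanish on cross label pairs, so b ≤ n — b_le_n_of_surjective), hence powers of any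
single cell have loss → 0 and FRESH hosts per t are necessary; live regime |G| ≍ n², a ≍ e ≍ n, b ≍
n² (χ boundedly non-surjective). [difficulty: XL] (why it might fail: n=1 asks for TPP-type packings
abe ≥ c|G|^(3/2) — the packing bound with CONSTANT loss, achieved in no known group (BCGPU2023
§1.1); for A = G it is ¬FibrePacking, which holds in every searched cell; a twisted packing bound
abe ≤ C·[G:A]·n·|G| would refute it outright.) [CohnUmans2003, arXiv:1207.6528,
BlasiakCohnGrochowPrattUmans2023, CohnKleinbergSzegedyUmans2005, doi:10.1007/978-3-319-43932-7]
#2 AbelianReesFamily (crux) — The flagship construction (card C1 in its cleanest host family): ∃ c >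
0 ∀ t ∃ finite abelian G with |G| ≥ t, n ≥ 1, a sandwich matrix P : [n]×[n] → G ∪ {0} and a strict
realization (φ,ψ,χ into the nonzero elements (r,g,λ) of the Rees matrix semigroup M⁰(G;n,n;P),
product (r,g,λ)(ι,h,γ) = (r, g·P[λ,ι]·h, γ) or 0) of ⟨a,b,e⟩ with c·(|G|·n²)^(3/2) ≤ abe. Host
blocks: |G| blocks of size n (ReesHostBlocks, abelian case), so this is X with t = |G| comparable
blocks (AbelianReesGivesTarget). [difficulty: XL] (why it might fail: FibrePacking (rank 3) refutes
it outright; the fibre reduction already kills |G| ≤ 3, full fibres, identity P (BrandtNoGain) and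
collisions, leaving only zero-free twisted P with latin bijections — and the gain needed over the
sum of cubes is c·|G|^(1/2) → ∞ where not even 1+δ is known.) [arXiv:1207.6528, CohnUmans2003,
CohnKleinbergSzegedyUmans2005, doi:10.1007/978-3-319-43932-7]
#3 FibrePacking (crux) — NEGATIVE side (card C3 localised; staffed for refuters/provers): for every
finite abelian G, n, sandwich P and every strict realization of ⟨a,b,e⟩ in the P-twisted FIBRE
tensor F_P((λ,g),(ι,h)) = g·P[λ,ι]·h ∈ G ∪ {0} (left/right index sets [n]×G, output G) one has abe ≤
n·|G|. By the fibre reduction (rows of φ(i,·) and columns of ψ(·,k) are constant; each (row ρ,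
column γ) pair carries a realization of ⟨a_ρ,b,c_γ⟩ in F_P and abe = Σ_ργ a_ρ·b·c_γ) it implies abe
≤ n³|G| = sum of cubes for EVERY abelian Rees host, hence ¬AbelianReesFamily and "abelian sandwich
matrices never beat the sum of cubes". For P = identity it holds with equality cases (CohnUmans2003
Lemma 3.1 fibrewise). [difficulty: M] (why it might fail: A zero-free twisted P with latin
bijections σ_j, π_j and a value set V ⊂ G, |V| = a·e ≤ n², avoided by all bi-permuted P-differences
could pack b up to n|G|/max(a,e) ≫ |G|/n — exactly the hoped-for design; smallest open cells |G| ≥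
5, n ≥ 3, unsearched.) [CohnUmans2003, BlasiakCohnGrochowPrattUmans2023, arXiv:1104.5097,
arXiv:1207.6528]
#4 ReesBeatsSumOfCubes (crux) — MILESTONE (card C2, first informative bit, any finite group G): some
Rees matrix host M⁰(G;n,n;P) of dimension n²|G| < 31250 strictly realizes ⟨a,b,e⟩ with abe > n³·Σ_χ
d_χ(G)³ (the host's sum of cubes; blocks n·d_χ), i.e. proves ω < 3 through a host smaller than the
smallest group known to do so (CKSU2005 §2: G = (Z_5³)² ⋊ Z_2, |G| = 2·5⁶ = 31250; no group of order
< 128 via subgroups). n = 1 is the pure group case, so a small GROUP example also closes it.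
[difficulty: L] (why it might fail: BrandtNoGain + fibre/collision lemmas leave only zero-free
twisted sub-rectangles of P; for abelian G FibrePacking forbids it, for non-abelian G the BCGPU Cor
3.5 gap |S||T||U| ≤ |G|^(3/2)/√2 + |G| may transfer fibrewise; TPP searches to order 55 found no
small group host.) [CohnKleinbergSzegedyUmans2005, arXiv:1305.0448, arXiv:1104.5097,
BlasiakCohnGrochowPrattUmans2023]
#5 RookIdealGain (crux) — J-ORDER RANK DROP (the card's second freedom, independent of sandwich
matrices): for some m, r a strict realization of ⟨a,b,e⟩ in the rank-≤r ideal of the rook monoid R_m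
(0/1 m×m matrices with ≤ 1 one per row and column, encoded over ZMod 2 where rook products are
exact; ≅ symmetric inverse monoid I_m) beats that ideal's sum of cubes Σ_(s≤r) C(m,s)³·Σ_(λ⊢s) d_λ³
(Solomon 2002: ℂ[R_m^(≤r)] ≅ ⊕_(s≤r) M_C(m,s)(ℂ[S_s])), hence ω < 3 through an INVERSE semigroup. By
BrandtNoGain the images cannot sit in one D-class: factors must live in higher ranks than χ and
cross products must drop rank (prescribed-intersection families of domains/ranges). [difficulty: L]
(why it might fail: Per D-class Brandt hosts buy nothing (BrandtNoGain); cross-rank realizations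
need set systems with |D_ij ∩ E_jk| prescribed and all other intersections wrong-sized, which
Frankl–Wilson-type bounds may cap below the ≈1.5× counting window at r = 3; larger r meets growing
S_s blocks.) [doi:10.1016/s0021-8693(02)00004-2, doi:10.1016/j.jcta.2005.08.004, arXiv:1207.6528,
BlasiakChurchCohnGrochowUmans2017]
#9 RealizationRestricts (support) — Cohn–Umans 2013 Prop 9 in strict form, for ANY partial
multiplication m : α × β → γ ∪ {0} (covers ℂ[S], ℂ₀[S], Rees hosts and fibre tensors): a strict
realization (φ,ψ,χ) of ⟨a,b,e⟩ makes ⟨a,b,e⟩ a restriction of the based tensor [m(x,y) = z]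
(coordinate projections; same proof as RealizesTPP.tensorRestrictsTo in GroupAlgebraTensor).
[difficulty: provable-now] [arXiv:1207.6528, CohnUmans2003]
#9 BlockRestrictionBound (support) — The Cohn–Umans inequality in pure tensor form: ⟨a,b,e⟩ ≤ ⊕_i
⟨d_i,d_i,d_i⟩ (d_i ≥ 1) ⟹ (abe)^(ω/3) ≤ Σ_i d_i^ω. Proof = rpow_omega_le_sum_blockDegrees_rpow
(CohnUmansTPPProofs) with the group replaced by the restriction hypothesis: kroneckerPow of the
restriction, kroneckerPow_matMulDirectSum, tensorRank_blockPiTensor_le, ⟨a,b,e⟩^⊗N ≅ ⟨a^N,b^N,e^N⟩,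
rpow_omega_div_three_le_tensorRank, exists_tensorRank_matMulTensor_le_rpow, N-th roots, ε → 0.
[difficulty: provable-now] [CohnUmans2003, CohnKleinbergSzegedyUmans2005, Blaser2013,
BurgisserClausenShokrollahi1997]
#9 ReesHostBlocks (support) — Blocks of a Rees host: for a finite group G with Wedderburn iso ℂ[G] ≃
∏_i M_(d_i)(ℂ) (exists_algEquiv_pi_matrix, proved), any n and ANY sandwich P (invertibility not
needed), the contracted structure tensor of M⁰(G;n,n;P) in the semigroup basis restricts from ⊕_i
⟨n·d_i, n·d_i, n·d_i⟩: ℂ₀[M⁰] = (M_n(ℂ[G]), X∘Y = X·P̂·Y) and X ↦ X·P̂ is linear, so T_∘ = T_(M_n(ℂ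
G)) ∘ (·P̂, id, id); then M_n(∏ M_(d_i)) ≅ ∏ M_(n d_i) and
structureTensor_blockBasis_eq_matMulDirectSum. Abelian case: all d_i = 1 (AddChar diagonalisation,
tensorRank_addGroupAlgTensor_le). [difficulty: provable-now] [doi:10.1007/978-3-319-43932-7,
CohnUmans2003, CohnKleinbergSzegedyUmans2005]
#9 BrandtNoGain (support) — Inverse single-D-class hosts buy nothing (this session's lemma; Morita
invariance at the monomial level): a strict realization of ⟨a,b,e⟩ in the Brandt semigroup B(G,n) =
M⁰(G;n,n;Id) has abe ≤ n³·a'b'e' for some TPP triple (a',b',e') of G (RealizesTPP). Proof: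
rows/columns are functions R(i), m(j), C(k); consistency forces φ(i,j) = (R i, s_i τ_j, m j), ψ(j,k)
= (m j, τ_j⁻¹ u_k, C k), χ(i,k) = (R i, s_i u_k, C k); for each (ρ,μ,γ) the fibre sets (S_ρ,T_μ,U_γ)
satisfy the TPP, and abe = Σ_ρμγ |S_ρ||T_μ||U_γ|. [difficulty: provable-now] [CohnUmans2003,
arXiv:1207.6528, doi:10.1016/j.jcta.2005.08.004]
#9 AbelianReesGivesTarget (support) — Glue: AbelianReesFamily → BlockRestrictionFamily, via
ReesHostBlocks in the abelian case (p = |G| blocks d ≡ n, so Σ d_i² = |G|n², t·n² ≤ |G|n² from t ≤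
|G|), RealizationRestricts and TensorRestrictsTo.trans; abe ≥ 1 from c·(|G|n²)^(3/2) > 0.
[difficulty: provable-now] [CohnKleinbergSzegedyUmans2005, Blaser2013]
#9 FibreLift (support) — a strict fibre realization of ⟨a,b,e⟩ in F_P lifts to a strict realization
of ⟨n·a,b,n·e⟩ in M⁰(G;n,n;P) (φ′((ρ,i),j) = (ρ,g_ij,λ_ij), ψ′(j,(γ,k)) = (ι_jk,h_jk,γ),
χ′((ρ,i),(γ,k)) = (ρ,χ_ik,γ)). [difficulty: provable-now; candidate fibreLift_proof attached]
[arXiv:1207.6528]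
#9 DegreeLeIndexAbelian (support) — χ(1) ≤ [G:A] for every abelian subgroup A of a finite group G
(Isaacs1976 Problem 2.9(b)); same statement as CongruenceTowerPacking.DegreeLeIndexAbelian
(stmt-MatrixMultiplication-12345, proved: DegreeLeIndexAbelian_proof). [difficulty: proved]
[Isaacs1976]
#9 BlockRestrictionFamilyOfFibreDesigns (support, glue) — FibreDesignFamily → FibreLift →
BlockRestrictionFamily. [difficulty: provable-now; candidate blockRestrictionFamily_of_subs
attached, 74 lines] [CohnUmans2003, arXiv:1207.6528, Isaacs1976]

TWO-LAYER PLAN. DECOMPOSITION FILED (2026-08-17, crux-strategist, BC2 redirect of the deciding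
crux): X ⇐ FibreDesignFamily ∧ FibreLift with the glue PROVED and `closes` re-glued over the pieces
(binders: BlockRestrictionBound, ReesHostBlocks, RealizationRestricts, DegreeLeIndexAbelian,
FibreLift, FibreDesignFamily); filed top-level because `route edit --split` is refused for non-final
cycles — a tenure planner may convert it into the formal split of X. The foreseen split of
AbelianReesFamily below is subsumed (FibreAssembly = FibreLift, proved;
TwistedFibreDesign-with-growth = FibreDesignFamily at A = G). Earlier plan: Foreseen glued splits
(none filed now): AbelianReesFamily ⇐ TwistedFibreDesign (one fibre pair with a_ρ·b·c_γ ≥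
c'·n|G|^(3/2),
i.e. ¬FibrePacking with growth) → FibreAssembly (n² compatible fibres sharing φ-rows/ψ-columns) →
AbelianReesFamily;
RookIdealGain ⇐ CrossRankDesign (domain/range set systems with prescribed intersections) →
LabelSeparation (S_s-part TPP on
the full-overlap pairs) → RookIdealGain; FibrePacking ⇐ CollisionLemma (a_ρ or c_γ > n ⇒ b ≤ n) →
ZeroFreeTwistedCase →
FibrePacking. A general-semigroup host item (Munn–Ponizovskii: ℂ₀[S] semisimple iff all sandwich
matrices invertible;
Steinberg/Okniński) is added only if a crux instance needs a host outside the two explicit families.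

KILL CRITERIA. Deciding leaf: a twisted packing bound abe ≤ C·[G:A]·n·|G| (or any o(n|G|^(3/2))
bound uniform in t·[G:A]² ≤ |G|) for strict fibre realizations = ¬FibreDesignFamily kills the
present cone (X then has no typed source left but RookIdealGain-type families, not filed: item cap);
FibrePacking proved kills only its A = G sub-case. FibrePacking PROVED ⇒ drop AbelianReesFamily
(close the abelian sandwich sub-line) and pivot rank 2 to RookIdealGain /
non-abelian Rees hosts; FibrePacking proved AND a Frankl–Wilson-type cap refuting RookIdealGain for
all r ≤ 3 ⇒ close the route
`refuted:AbelianReesFamily` with census "semigroup bases reduce to their maximal subgroups" (a new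
catalogued barrier:
MonomialSemisimpleHostBarrier). A packing-gap theorem for arbitrary restrictions ⟨a,b,e⟩ ≤ ⊕⟨d_i⟩
with t comparable blocks
(¬BlockRestrictionFamily) closes the route outright and is itself a Literature-grade negative result
shared with card
strassen-defect-cocycle-price. ω = 2 proved elsewhere moots it. Exhaustive search (kit) over |G| ≤
16, n ≤ 4 and rook ideals
m ≤ 6, r ≤ 3 with NO gain demotes ranks 2/4/5 but does not close.

NOT DECOMPOSED YET. Wider leaves not filed: general small-degree hosts (comparability t·d_max(G)² ≤
|G| via the tree’s maxCharDegree instead of an abelian subgroup of small index — admits Lie-type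
hosts, less killable) and a rook/inverse-semigroup FAMILY crux (Solomon blocks ⊕_s M_C(m,s)(ℂ[S_s])
as a restriction statement + a cross-rank design family); both are alternative typed sources of X
for a later resplit (items now 15/15). The general regular-semigroup host (Munn–Ponizovskii
semisimplicity, Steinberg's groupoid basis for inverse semigroups) — a
Literature vendoring job, requested only when an instance needs it; non-abelian Rees families
(blocks n·d_χ of unequal size
need the card's convexity formula ω ≤ 2/(1 − 2·log(1/c)/log t) with weights); slice rank of the
Rees/rook host tensors over
F_p (re-enters only if a construction needs powers of a FIXED host — then
IrreversibilityBarrier/TricoloredSumFree must be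
recomputed); certified small-case searches (kit jobs) — to be attached as evidence to ranks 3–5 by
refuters, not items.

CHEAPEST FALSIFIER. (i) Prove FibrePacking in the zero-free twisted case by an injectivity/LYM
argument in G × [n]² (the collision and full-fibre
cases are already done in NOTES.md of this unit) — an afternoon's attempt; if the Cauchy–Schwarz of
BCGPU Thm 3.2 survives the
twist with constant 1, the abelian playground closes. (ii) kit: exhaustive strict-realization search
(Hedtke–Murthy-style
backtracking, arXiv:1305.0448 §3) over M⁰(Z_m;n,n;P), m ≤ 9, n ≤ 3, all P up to equivalence, and
rook ideals m ≤ 5, r ≤ 3,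
reporting max abe against n·|G| per fibre and against the sum of cubes. Run here by hand: |G| ≤ 3
any n, and (|G|,n) = (5,2)
with (a,b,e) = (2,3,2): no gain (NOTES.md §Findings).

NUMBERS. Sum of cubes to beat: Rees host n³·Σ_χ d_χ³ (abelian: n³|G|); rook ideal r = 3: 10·C(m,3)³
+ 2·C(m,2)³ + m³ + 1 vs flattening
cap dim^(3/2) ≈ (6·C(m,3)²+2·C(m,2)²+m²+1)^(3/2) (window ≈ 1.5× at large m). Smallest known host
beating its sum of cubes: CKSU2005
§2, |G| = 2n⁶, n ≥ 5 (31250), best ω < 2.9088 at n = 17; no group of order < 128 via three subgroups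
(CKSU2005 §2, GAP);
TPP capacity tables for all groups of order ≤ 55 (arXiv:1305.0448), ≤ 24 exhaustive
(arXiv:1104.5097). Group packing gaps:
|S||T||U| ≤ |G| abelian (CohnUmans2003 Lemma 3.1), ≤ |G|^(3/2)/√2 + |G| always, ≤
|G|^(3/2)/n(G)^(1/2) + |G| non-abelian
(BlasiakCohnGrochowPrattUmans2023 Thm 3.2, Cor 3.5). Target formula: loss c with t comparable blocks
certifies
ω ≤ 2/(1 − 2·log(1/c)/log t) (card; Strassen: t = 7, c = 2/√7 gives 2.807). Items at open: 11 (1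
target, 4 cruxes, 5 support, 1 assembly). Items after the 2026-08-17 decomposition: 15 (1 target, 5
cruxes, 8 support, 1 assembly); cone of `closes`: 6 binders (3 closed, FibreLift +
DegreeLeIndexAbelian provable-now/proved elsewhere, FibreDesignFamily open).

DEFINITION REQUESTS. None required at open: realizations, Rees products, fibre tensors and rook
matrices are inlined over Mathlib (Option.map,
Matrix (Fin m) (Fin m) (ZMod 2)) and the tree's TensorRestrictsTo / matMulDirectSum / matMulTensor /
RealizesTPP /
charDegreePowSum / BlockAlgebraC. Wanted later as cite facts (not load-bearing for any item):
Munn–Ponizovskii semisimplicity of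
contracted semigroup algebras (Clifford–Preston Thm 5.? / Steinberg 2016 Ch. 5,
doi:10.1007/978-3-319-43932-7) and Solomon 2002
ℂ[R_n] ≅ ⊕_s M_C(n,s)(ℂ[S_s]) (doi:10.1016/s0021-8693(02)00004-2) — filed when a host outside the
two explicit families is used.

Novelty: Searches (2026-08-15): `lit search --source zbmath "triple product property matrix multiplication"`
(8: Neumann 2011, HM
arXiv:1104.5097, HHMM arXiv:1305.0448, Hedtke arXiv:1107.5973/1107.5969, BCGPU arXiv:2410.14905 —
all GROUP hosts); `lit
search --source zbmath "semigroup algebra matrix multiplication exponent"` (2, irrelevant); `lit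
search --source crossref
"inverse semigroup algebra fast matrix multiplication"` (10, irrelevant: semigroup forum structure
papers); `lit galaxy search
"strict realization matrix multiplication algebra" --star all` (0) and `"Rees matrix semigroup
algebra fast matrix
multiplication" --star all` (0; panama/pdf queue time-outs); `lit read arxiv:1207.6528 --grep
realiz|strict|semigroup` (Def 8,
Prop 9–10, p. 9 remark read); `lit read arxiv:math/0511460` §2 (sum of cubes, 2n⁶) and
`arxiv:1305.0448` (search tables);
local searchd down (ECONNRESET), openalex/arxiv rate-limited (429) — the card's own audit ran the
complementary arXiv/galaxy
queries ("triple product property" 13 rows, "inverse semigroup" pdf star, zbMATH ×3) with the same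
null result.
Nearest prior art found: arXiv:1207.6528 (Cohn–Umans 2013) Def 8 / Prop 9–10 — realization of
⟨ℓ,m,n⟩ in an arbitrary based
algebra and the block inequality for semisimple hosts, with the explicit remark that few strict
examples beyond group algebras
are known; their chosen non-group class is coherent configurations (weighted, ω_s). Semigroup side:
Steinberg 2006/2016,
Solomon 2002, Malandro arXiv:0905.13  [refs: 1104.5097, 1305.0448, 1107.5973, 2410.14905, 1207.6528, math/0511460, 0905.1340, arxiv:1207.6528, arxiv:math/0511460, arxiv:1305.0448]

Barriers (technique_class: semigroup-algebra-embedding, sandwich-matrix-design): - technique_class: semigroup-algebra-embedding, sandwich-matrix-design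
- Literature.Barriers.MatrixMultiplication.QuasirandomBarrier: BCGPU2023 Thm 3.2 / Cor 3.5 are
proved for TPP triples in GROUPS by unitary non-abelian Fourier analysis; the Rees host's semigroup
basis differs from the matrix-unit ⊗ group basis by the non-unitary sandwich map X ↦ X·P̂, so the
proofs do not transfer verbatim — whether the packing gap survives the twist IS crux FibrePacking
(abelian) and the why-it-might-fail of ReesBeatsSumOfCubes (non-abelian); evasion claimed only in
that precise sense.
- Literature.Barriers.MatrixMultiplication.NormalizerBarrier: concerns TPP via three SUBGROUPS;
realizations here are arbitrary injections into a semigroup (no subgroups, no normalisers); n = 1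
sub-case inherits it and is not where gain is sought.
- Literature.Barriers.MatrixMultiplication.YoungSubgroupBarrier: S_n-specific; re-enters for rook
ideals with large rank r (blocks C(m,s)·d_λ, d_λ up to √(s!)) — RookIdealGain is therefore posed at
small fixed r, where S_s ∈ {S_0..S_3} has d_λ ≤ 2.
- Literature.Barriers.MatrixMultiplication.TricoloredSumFreeBarrier: engine = sub-maximal slice rank
of the host's multiplication table under powers in bounded-exponent abelian groups; the route uses
each host ONCE (families S_t, no powers) and over ℂ the contracted Rees/rook tensors restrict from
direct sums of matrix multiplication tensors (full slice rank, BlasiakChurchCohnGrochowUmans2017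
App. B); if a construction

Novelty grade: new-combination — Refuter route-review 2026-08-15 (memo review-ReesMunnRealization.md attached as route evidence). Grade new-combination: the engine (strict realizations of <a,b,e> in a based algebra + the block inequality) is Cohn–Umans 2013 Def 8/Prop 9–10 verbatim, and the hosts (contracted Rees matrix semigroup a (refuter refuter-rreview-route-MatrixMultiplicati-88cb055c-g2-0, 2026-08-15T14:48:14Z; prior: arXiv:1207.6528 (Cohn–Umans 2013, Def 8 / Prop 9–10: realizations in based algebras; p.9 remark), CohnUmans2003 (Lemma 3.1 abelian packing; Thm 4.1 block inequality), CohnKleinbergSzegedyUmans2005 (§2 smallest beating host 2·5^6), doi:10.1016/s0021-8693(02)00004-2 (Solomon 2002, rook monoid algebra blocks), doi:10.1007/978-3-319-43932-7 (Steinberg 2016, Rees/inverse semigroup algebras), BlasiakCoh)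

History (route lifecycle, newest last):
- 2026-08-16T04:11:15Z · AUTO-CRUX (backfill): BlockRestrictionFamily — hypotheses of the deciding theorem that nothing in the route derives are cruxes (operator:999:1085951)
- 2026-08-22T08:21:29Z · DORMANT — reconciler: no traction for 5.2 d (last activity statement-grounded at 2026-08-17T02:55:19Z); parked, not closed — `ledger route dormant route-MatrixMultiplicat (operator:999:756665)

sub-problem: MatrixMultiplication · status: dormant · opened planner-plancard-MatrixMultiplication-MatrixM-41605ca3-0 2026-08-15T11:33:11Z · rev 6 · ledger route-MatrixMultiplication-ReesMunnRealization
GENERATED by the gate from the ledger (D-0016/17). Provers cite these decls: `theorem foo : Summit.MatrixMultiplication.MatrixMultiplication.Theses.ReesMunnRealization.<Decl> := …` in Summits/MatrixMultiplication/MatrixMultiplication/Theorems/<Name>.lean.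
-/

namespace Summit.MatrixMultiplication.MatrixMultiplication.Theses.ReesMunnRealization

open scoped BigOperators Topology Manifold Classical MeasureTheory ProbabilityTheory Matrix InnerProductSpace ComplexConjugate ContinuousMap
open Filter Set Function TopologicalSpace MeasureTheory

attribute [summit_statement] _root_.MatrixMultiplication

/-- item stmt-MatrixMultiplication-4368 · target (kind.auto-crux: conjecture-grade) · rank 0 · open · by planner
why it might fail: A priori STRONGER than ω = 2 (ω = 2 only yields loss c → 0 like m^(−o(1))); every known restriction family (Strassen-type ⟨kN⟩ ≤ R(⟨k⟩)⊙⟨N⟩, CKSU group hosts) has c → 0 as t → ∞; a packing-gap theorem for restrictions into ⊕⟨d_i⟩ with many comparable blocks would kill it.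
sources: arXiv:1207.6528, CohnKleinbergSzegedyUmans2005, CohnUmans2003, BlasiakCohnGrochowPrattUmans2023
[target] X: ∃ c > 0 ∀ t ∃ block sizes d_1..d_p ≥ 1 (p ≥ 1) and a,b,e with abe ≥ 1, ⟨a,b,e⟩ ≤ ⊕_i
⟨d_i,d_i,d_i⟩ (TensorRestrictsTo), c·(Σ d_i²)^(3/2) ≤ abe and t·d_i² ≤ Σ_j d_j² for all i. -/
@[route_item "route-MatrixMultiplication-ReesMunnRealization"]
def BlockRestrictionFamily : Prop :=
  ∃ c : ℝ, 0 < c ∧ ∀ t : ℕ, ∃ (p : ℕ) (d : Fin p → ℕ) (a b e : ℕ), 0 < p ∧ (∀ i, 1 ≤ d i) ∧ 1 ≤ a * b * e ∧ Literature.Computability.AlgebraicComplexity.TensorRestrictsTo (Literature.Computability.AlgebraicComplexity.matMulDirectSum ℂ d d d) (Literature.Computability.AlgebraicComplexity.matMulTensor ℂ a b e) ∧ c * (∑ i, (d i : ℝ) ^ 2) ^ ((3 : ℝ) / 2) ≤ ((a * b * e : ℕ) : ℝ) ∧ ∀ i, (t : ℝ) * (d i : ℝ) ^ 2 ≤ ∑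 j, (d j : ℝ) ^ 2

/-- item stmt-MatrixMultiplication-18277 · crux · rank 2 · open · by planner
why it might fail: n=1 asks for TPP-type packings abe ≥ c|G|^(3/2) (packing bound with CONSTANT loss, achieved in no known group, BCGPU2023 §1.1); for A = G it is ¬FibrePacking, which holds in every searched cell; a twisted packing bound abe ≤ C·[G:A]·n·|G| would refute it outright.
sources: CohnUmans2003, arXiv:1207.6528, BlasiakCohnGrochowPrattUmans2023, CohnKleinbergSzegedyUmans2005, doi:10.1007/978-3-319-43932-7
[crux] DESIGN piece of the split of BlockRestrictionFamily, in the sharp FIBRE form to which the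
refuters reduced every Rees design: ∃ c>0 ∀ t ∃ finite group G with an ABELIAN SUBGROUP A, t·[G:A]²
≤ |G|, n ≥ 1, sandwich P : [n]×[n] → G∪{0} and a strict realization (φ,ψ,χ) of ⟨a,b,e⟩ in the
P-twisted fibre tensor F_P((λ,g),(ι,h)) = g·P[λ,ι]·h (φ,ψ into [n]×G, χ into G; same Option-encoding
as FibrePacking) with c·n·|G|^(3/2) ≤ abe. Flattenings of F_P force abe ≤ n|G|^(3/2), so this is
constant loss; FibrePacking is exactly the bound abe ≤ n|G| for A = G, so the abelian sub-case is
¬FibrePacking-with-growth; admitted non-abelian hosts: generalized dihedral / Frobenius A⋊C_k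
(character degrees ≤ k), Heisenberg-type. With FibreLift (copy into all n² fibres: realization of
⟨na,b,ne⟩ in M⁰(G;n,n;P)) and DegreeLeIndexAbelian (route CongruenceTowerPacking, PROVED) it yields
X with blocks n·d_χ, t·(n d_χ)² ≤ n²·t[G:A]² ≤ n²|G| (glue blockRestrictionFamily_of_subs,
sorry-free, attached). n = 1 is a constant-loss TPP-type packing in a virtually abelian group.
[difficulty: XL] -/
@[route_item "route-MatrixMultiplication-ReesMunnRealization", crux]
def FibreDesignFamily : Prop :=
  ∃ c : ℝ, 0 < c ∧ ∀ t : ℕ, ∃ (G : Type) (_ : Group G) (_ : Fintype G) (A : Subgroup G) (n a b e : ℕ) (P : Fin n → Fin n → Option G) (φ : Fin a × Fin b → Fin n × G) (ψ : Fin b × Fin e → Fin n × G) (χ : Fin a × Fin e → G), (∀ x ∈ A, ∀ y ∈ A, x * y = y * x) ∧ 1 ≤ n ∧ t * A.index ^ 2 ≤ Fintype.card G ∧ (∀ x y z, ((P (φ x).1 (ψ y).1).map (fun p => (φ x).2 * p * (ψ y).2) = some (χ z) ↔ (z.1 = x.1 ∧ x.2 = y.1 ∧ z.2 = y.2))) ∧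 c * ((n : ℝ) * (Fintype.card G : ℝ) ^ ((3 : ℝ) / 2)) ≤ ((a * b * e : ℕ) : ℝ)

/-- item stmt-MatrixMultiplication-4369 · crux · rank 2 · open · by planner
why it might fail: FibrePacking (rank 3) refutes it outright; the fibre reduction already kills |G| ≤ 3, full fibres, identity P (BrandtNoGain) and collisions, leaving only zero-free twisted P with latin bijections — and the gain needed over the sum of cubes is c·|G|^(1/2) → ∞ where not even 1+δ is known.
sources: arXiv:1207.6528, CohnUmans2003, CohnKleinbergSzegedyUmans2005, doi:10.1007/978-3-319-43932-7
[crux] The flagship construction (card C1 in its cleanest host family): ∃ c > 0 ∀ t ∃ finite abelian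
G with |G| ≥ t, n ≥ 1, a sandwich matrix P : [n]×[n] → G ∪ {0} and a strict realization (φ,ψ,χ into
the nonzero elements (r,g,λ) of the Rees matrix semigroup M⁰(G;n,n;P), product (r,g,λ)(ι,h,γ) = (r,
g·P[λ,ι]·h, γ) or 0) of ⟨a,b,e⟩ with c·(|G|·n²)^(3/2) ≤ abe. Host blocks: |G| blocks of size n
(ReesHostBlocks, abelian case), so this is X with t = |G| comparable blocks
(AbelianReesGivesTarget). [difficulty: XL] -/
@[route_item "route-MatrixMultiplication-ReesMunnRealization"]
def AbelianReesFamily : Prop :=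
  ∃ c : ℝ, 0 < c ∧ ∀ t : ℕ, ∃ (G : Type) (_ : CommGroup G) (_ : Fintype G) (n a b e : ℕ) (P : Fin n → Fin n → Option G) (φ : Fin a × Fin b → Fin n × G × Fin n) (ψ : Fin b × Fin e → Fin n × G × Fin n) (χ : Fin a × Fin e → Fin n × G × Fin n), 1 ≤ n ∧ t ≤ Fintype.card G ∧ (∀ x y z, ((P (φ x).2.2 (ψ y).1).map (fun p => ((φ x).1, (φ x).2.1 * p * (ψ y).2.1, (ψ y).2.2)) = some (χ z) ↔ (z.1 = x.1 ∧ x.2 = y.1 ∧ z.2 = y.2))) ∧ c * ((Fintype.card G : ℝ) * (n : ℝ) ^ 2) ^ ((3 : ℝ) / 2) ≤ ((a * b * e : ℕ) : ℝ)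

/-- item stmt-MatrixMultiplication-4370 · crux · rank 3 · open · by planner
why it might fail: A zero-free twisted P with latin bijections σ_j, π_j and a value set V ⊂ G, |V| = a·e ≤ n², avoided by all bi-permuted P-differences could pack b up to n|G|/max(a,e) ≫ |G|/n — exactly the hoped-for design; smallest open cells |G| ≥ 5, n ≥ 3, unsearched.
sources: CohnUmans2003, BlasiakCohnGrochowPrattUmans2023, arXiv:1104.5097, arXiv:1207.6528
[crux] NEGATIVE side (card C3 localised; staffed for refuters/provers): for every finite abelian G,
n, sandwich P and every strict realization of ⟨a,b,e⟩ in the P-twisted FIBRE tensor F_P((λ,g),(ι,h))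
= g·P[λ,ι]·h ∈ G ∪ {0} (left/right index sets [n]×G, output G) one has abe ≤ n·|G|. By the fibre
reduction (rows of φ(i,·) and columns of ψ(·,k) are constant; each (row ρ, column γ) pair carries a
realization of ⟨a_ρ,b,c_γ⟩ in F_P and abe = Σ_ργ a_ρ·b·c_γ) it implies abe ≤ n³|G| = sum of cubes
for EVERY abelian Rees host, hence ¬AbelianReesFamily and "abelian sandwich matrices never beat the
sum of cubes". For P = identity it holds with equality cases (CohnUmans2003 Lemma 3.1 fibrewise).
[difficulty: M] -/
@[route_item "route-MatrixMultiplication-ReesMunnRealization"]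
def FibrePacking : Prop :=
  ∀ (G : Type) [CommGroup G] [Fintype G] (n a b e : ℕ) (P : Fin n → Fin n → Option G) (φ : Fin a × Fin b → Fin n × G) (ψ : Fin b × Fin e → Fin n × G) (χ : Fin a × Fin e → G), (∀ x y z, ((P (φ x).1 (ψ y).1).map (fun p => (φ x).2 * p * (ψ y).2) = some (χ z) ↔ (z.1 = x.1 ∧ x.2 = y.1 ∧ z.2 = y.2))) → a * b * e ≤ n * Fintype.card G

/-- item stmt-MatrixMultiplication-4371 · crux · rank 4 · open · by planner
why it might fail: BrandtNoGain + fibre/collision lemmas leave only zero-free twisted sub-rectangles of P; for abelian G FibrePacking forbids it, for non-abelian G the BCGPU Cor 3.5 gap |S||T||U| ≤ |G|^(3/2)/√2 + |G| may transfer fibrewise; TPP searches to order 55 found no small group host.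
sources: CohnKleinbergSzegedyUmans2005, arXiv:1305.0448, arXiv:1104.5097, BlasiakCohnGrochowPrattUmans2023
[crux] MILESTONE (card C2, first informative bit, any finite group G): some Rees matrix host
M⁰(G;n,n;P) of dimension n²|G| < 31250 strictly realizes ⟨a,b,e⟩ with abe > n³·Σ_χ d_χ(G)³ (the
host's sum of cubes; blocks n·d_χ), i.e. proves ω < 3 through a host smaller than the smallest group
known to do so (CKSU2005 §2: G = (Z_5³)² ⋊ Z_2, |G| = 2·5⁶ = 31250; no group of order < 128 via
subgroups). n = 1 is the pure group case, so a small GROUP example also closes it. [difficulty: L] -/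
@[route_item "route-MatrixMultiplication-ReesMunnRealization"]
def ReesBeatsSumOfCubes : Prop :=
  ∃ (G : Type) (_ : Group G) (_ : Fintype G) (n a b e : ℕ) (P : Fin n → Fin n → Option G) (φ : Fin a × Fin b → Fin n × G × Fin n) (ψ : Fin b × Fin e → Fin n × G × Fin n) (χ : Fin a × Fin e → Fin n × G × Fin n), (∀ x y z, ((P (φ x).2.2 (ψ y).1).map (fun p => ((φ x).1, (φ x).2.1 * p * (ψ y).2.1, (ψ y).2.2)) = some (χ z) ↔ (z.1 = x.1 ∧ x.2 = y.1 ∧ z.2 = y.2))) ∧ (n : ℝ) ^ 3 * Literature.RepresentationTheory.FiniteGroups.charDegreePowSum G 3 < ((a * b * e : ℕ) : ℝ) ∧ n ^ 2 * Fintype.card G < 31250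

/-- item stmt-MatrixMultiplication-4372 · crux · rank 5 · open · by planner
why it might fail: Per D-class Brandt hosts buy nothing (BrandtNoGain); cross-rank realizations need set systems with |D_ij ∩ E_jk| prescribed and all other intersections wrong-sized, which Frankl–Wilson-type bounds may cap below the ≈1.5× counting window at r = 3; larger r meets growing S_s blocks.
sources: doi:10.1016/s0021-8693(02)00004-2, doi:10.1016/j.jcta.2005.08.004, arXiv:1207.6528, BlasiakChurchCohnGrochowUmans2017
[crux] J-ORDER RANK DROP (the card's second freedom, independent of sandwich matrices): for some m,
r a strict realization of ⟨a,b,e⟩ in the rank-≤r ideal of the rook monoid R_m (0/1 m×m matrices with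
≤ 1 one per row and column, encoded over ZMod 2 where rook products are exact; ≅ symmetric inverse
monoid I_m) beats that ideal's sum of cubes Σ_(s≤r) C(m,s)³·Σ_(λ⊢s) d_λ³ (Solomon 2002: ℂ[R_m^(≤r)]
≅ ⊕_(s≤r) M_C(m,s)(ℂ[S_s])), hence ω < 3 through an INVERSE semigroup. By BrandtNoGain the images
cannot sit in one D-class: factors must live in higher ranks than χ and cross products must drop
rank (prescribed-intersection families of domains/ranges). [difficulty: L] -/
@[route_item "route-MatrixMultiplication-ReesMunnRealization"]
def RookIdealGain : Prop :=
  ∃ (m r a b e : ℕ) (φ : Fin a × Fin b → {A : Matrix (Fin m) (Fin m) (ZMod 2) // (∀ i, (Finset.univ.filter fun j => A i j = 1).card ≤ 1) ∧ (∀ j, (Finset.univ.filter fun i => A i j = 1).card ≤ 1) ∧ (Finset.univ.filter fun ij : Fin m × Fin m => A ij.1 ij.2 = 1).card ≤ r}) (ψ : Fin b × Fin e → {A : Matrix (Fin m) (Fin m) (ZMod 2) // (∀ i, (Finset.univ.filter fun j => A i j = 1).card ≤ 1) ∧ (∀ j, (Finset.univ.filter fun i => A i j = 1).card ≤ 1)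 ∧ (Finset.univ.filter fun ij : Fin m × Fin m => A ij.1 ij.2 = 1).card ≤ r}) (χ : Fin a × Fin e → {A : Matrix (Fin m) (Fin m) (ZMod 2) // (∀ i, (Finset.univ.filter fun j => A i j = 1).card ≤ 1) ∧ (∀ j, (Finset.univ.filter fun i => A i j = 1).card ≤ 1) ∧ (Finset.univ.filter fun ij : Fin m × Fin m => A ij.1 ij.2 = 1).card ≤ r}), (∀ x y z, ((φ x).1 * (ψ y).1 = (χ z).1 ↔ (z.1 = x.1 ∧ x.2 = y.1 ∧ z.2 = y.2))) ∧ ∑ s ∈ Finset.range (r + 1), (m.choose s : ℝ) ^ 3 * Literature.RepresentationTheory.FiniteGroups.charDegreePowSum (Equiv.Perm (Fin s)) 3 < ((a * b * e : ℕ) : ℝ)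

/-- item stmt-MatrixMultiplication-18278 · support · rank 9 · closed · proved by Summit.MatrixMultiplication.MatrixMultiplication.Theorems.FibreLift_proof @ 2b946698f8ae (prover) · by planner
sources: arXiv:1207.6528, doi:10.1007/978-3-319-43932-7, CohnUmans2003
[support] LIFT piece of the split of BlockRestrictionFamily (provable now; sorry-free candidate
proof fibreLift_proof attached as evidence): for ANY group G, n, sandwich P, a strict realization
(φ,ψ,χ) of ⟨a,b,e⟩ in the fibre tensor F_P lifts to a strict realization of ⟨n·a, b, n·e⟩ in the
Rees matrix semigroup M⁰(G;n,n;P): index [n·a] = [n]×[a] by (row label ρ, i) and [n·e] = [n]×[e] by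
(column label γ, k) via finProdFinEquiv and put φ'((ρ,i),j) = (ρ, g_ij, λ_ij), ψ'(j,(γ,k)) = (ι_jk,
h_jk, γ), χ'((ρ,i),(γ,k)) = (ρ, χ_ik, γ); the Rees product (ρ, g·P[λ,ι]·h, γ) reproduces the fibre
condition in every fibre and distinct fibres are separated by their labels. The converse (pigeonhole
over the n² fibres, abe = Σ a_ρ·b·e_γ) is the refuters' FibreReduction (evidence on
stmt-MatrixMultiplication-4369). [difficulty: provable-now] -/
@[route_item "route-MatrixMultiplication-ReesMunnRealization", crux]
def FibreLift : Prop :=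
  ∀ (G : Type) [Group G] (n a b e : ℕ) (P : Fin n → Fin n → Option G) (φ : Fin a × Fin b → Fin n × G) (ψ : Fin b × Fin e → Fin n × G) (χ : Fin a × Fin e → G), (∀ x y z, ((P (φ x).1 (ψ y).1).map (fun p => (φ x).2 * p * (ψ y).2) = some (χ z) ↔ (z.1 = x.1 ∧ x.2 = y.1 ∧ z.2 = y.2))) → ∃ (φ' : Fin (n * a) × Fin b → Fin n × G × Fin n) (ψ' : Fin b × Fin (n * e) → Fin n × G × Fin n) (χ' : Fin (n * a) × Fin (n * e) → Fin n × G × Fin n), ∀ x y z, ((P (φ' x).2.2 (ψ' y).1).map (fun p => ((φ' x).1, (φ' x).2.1 * p * (ψ' y).2.1, (ψ' y).2.2)) = some (χ' z) ↔ (z.1 = x.1 ∧ x.2 = y.1 ∧ z.2 = y.2))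

/-- item stmt-MatrixMultiplication-18279 · support · rank 9 · closed · proved by Summit.MatrixMultiplication.MatrixMultiplication.Theorems.reesMunn_degreeLeIndexAbelian_proof @ 2b946698f8ae (prover) · by planner
sources: Isaacs1976, CohnUmans2003
[support] Character degrees are at most the index of any abelian subgroup: for a finite group G, an
abelian subgroup A ≤ G and every d ∈ charDegrees G (dimension of an irreducible complex
representation), d ≤ [G:A] (Isaacs 1976, Problem 2.9(b); Ito's Thm 6.15 for normal A). SHARED with
route CongruenceTowerPacking (same statement, item stmt-MatrixMultiplication-12345, PROVED:
Theorems.DegreeLeIndexAbelian_proof) — re-asked here because the re-glued deciding theorem uses it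
to bound the Wedderburn block sizes d_i ≤ [G:A] (comparability t·(n d_i)² ≤ n²|G|). [difficulty:
proved] -/
@[route_item "route-MatrixMultiplication-ReesMunnRealization", crux]
def DegreeLeIndexAbelian : Prop :=
  ∀ (G : Type) [Group G] [Finite G] (A : Subgroup G), (∀ a ∈ A, ∀ b ∈ A, a * b = b * a) → ∀ d ∈ Literature.RepresentationTheory.FiniteGroups.charDegrees G, d ≤ A.index

/-- item stmt-MatrixMultiplication-18280 · support · rank 9 · open · by planner
sources: CohnUmans2003, arXiv:1207.6528, Isaacs1976, CohnKleinbergSzegedyUmans2005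
[support] GLUE of the typed decomposition of the deciding crux BlockRestrictionFamily
(crux-strategist, BC2 redirect): FibreDesignFamily → FibreLift → BlockRestrictionFamily (PROVED
sorry-free as
Summit.MatrixMultiplication.MatrixMultiplication.Theorems.blockRestrictionFamily_of_subs in the
attached Split2.lean / Cruxes workfile Lines/decomposition.lean; axioms propext, Classical.choice,
Quot.sound): lift the fibre design to a strict realization of ⟨na,b,ne⟩ in M⁰(G;n,n;P) (FibreLift);
Wedderburn blocks ℂ[G] ≃ ∏ M_(d_i) (exists_algEquiv_pi_matrix) and block sizes n·d_i; ⊕⟨n d_i⟩ ≥ R_P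
(closed ReesHostBlocks = reesHostBlocks_proof) ≥ ⟨na,b,ne⟩ (closed RealizationRestricts, CU2013 Prop
9); Σ(n d_i)² = n²|G| (sum_sq_blockDegrees_eq_card); d_i ∈ charDegrees G
(blockDegree_mem_charDegrees) ⇒ d_i ≤ [G:A] (closed DegreeLeIndexAbelian of route
CongruenceTowerPacking, Isaacs Problem 2.9(b)) ⇒ t(n d_i)² ≤ n²·t[G:A]² ≤ n²|G|; packing
c(|G|n²)^(3/2) = n²·(c·n|G|^(3/2)) ≤ n²·abe = (na)b(ne); (na)b(ne) ≥ 1. [difficulty: provable-now —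
proof attached as evidence; a prover lands it verbatim as theorem … :
ReesMunnRealization.BlockRestrictionFamilyOfFibreDesigns := blockRestrictionFamily_of_subs] -/
@[route_item "route-MatrixMultiplication-ReesMunnRealization"]
def BlockRestrictionFamilyOfFibreDesigns : Prop :=
  FibreDesignFamily → FibreLift → BlockRestrictionFamily

/-- item stmt-MatrixMultiplication-4373 · support · rank 9 · closed · proved by Summit.MatrixMultiplication.MatrixMultiplication.Theorems.RealizationRestricts_proof @ 4af2c4d4b598 (prover) · by planner
sources: arXiv:1207.6528, CohnUmans2003
[support] Cohn–Umans 2013 Prop 9 in strict form, for ANY partial multiplication m : α × β → γ ∪ {0}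
(covers ℂ[S], ℂ₀[S], Rees hosts and fibre tensors): a strict realization (φ,ψ,χ) of ⟨a,b,e⟩ makes
⟨a,b,e⟩ a restriction of the based tensor [m(x,y) = z] (coordinate projections; same proof as
RealizesTPP.tensorRestrictsTo in GroupAlgebraTensor). [difficulty: provable-now] -/
@[route_item "route-MatrixMultiplication-ReesMunnRealization", crux]
def RealizationRestricts : Prop :=
  ∀ (α β γ : Type) [Fintype α] [Fintype β] [Fintype γ] [DecidableEq α] [DecidableEq β] [DecidableEq γ] (m : α → β → Option γ) (a b e : ℕ) (φ : Fin a × Fin b → α) (ψ : Fin b × Fin e → β) (χ : Fin a × Fin e → γ), (∀ x y z, (m (φ x) (ψ y) = some (χ z) ↔ (z.1 = x.1 ∧ x.2 = y.1 ∧ z.2 = y.2))) → Literature.Computability.AlgebraicComplexity.TensorRestrictsTo (fun (z : γ) (x : α) (y : β) => if m x y = some z then (1 : ℂ) else 0) (Literature.Computability.AlgebraicComplexity.matMulTensor ℂ a b e)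

/-- item stmt-MatrixMultiplication-4374 · support · rank 9 · closed · proved by Summit.MatrixMultiplication.MatrixMultiplication.Theorems.blockRestrictionBound_proof @ cfe9b053e7fe (prover) · by planner
sources: CohnUmans2003, CohnKleinbergSzegedyUmans2005, Blaser2013, BurgisserClausenShokrollahi1997
[support] The Cohn–Umans inequality in pure tensor form: ⟨a,b,e⟩ ≤ ⊕_i ⟨d_i,d_i,d_i⟩ (d_i ≥ 1) ⟹
(abe)^(ω/3) ≤ Σ_i d_i^ω. Proof = rpow_omega_le_sum_blockDegrees_rpow (CohnUmansTPPProofs) with the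
group replaced by the restriction hypothesis: kroneckerPow of the restriction,
kroneckerPow_matMulDirectSum, tensorRank_blockPiTensor_le, ⟨a,b,e⟩^⊗N ≅ ⟨a^N,b^N,e^N⟩,
rpow_omega_div_three_le_tensorRank, exists_tensorRank_matMulTensor_le_rpow, N-th roots, ε → 0.
[difficulty: provable-now] -/
@[route_item "route-MatrixMultiplication-ReesMunnRealization", crux]
def BlockRestrictionBound : Prop :=
  ∀ (p : ℕ) (d : Fin p → ℕ) (a b e : ℕ), (∀ i, 1 ≤ d i) → Literature.Computability.AlgebraicComplexity.TensorRestrictsTo (Literature.Computability.AlgebraicComplexity.matMulDirectSum ℂ d d d) (Literature.Computability.AlgebraicComplexity.matMulTensor ℂ a b e) → ((a * b * e : ℕ) : ℝ) ^ (Literature.Computability.AlgebraicComplexity.omega ℂ / 3) ≤ ∑ i, (d i : ℝ) ^ Literature.Computability.AlgebraicComplexity.omega ℂ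

/-- item stmt-MatrixMultiplication-4375 · support · rank 9 · closed · proved by Summit.MatrixMultiplication.MatrixMultiplication.Theorems.reesHostBlocks_proof @ 1dd295dec660 (prover) · by planner
sources: doi:10.1007/978-3-319-43932-7, CohnUmans2003, CohnKleinbergSzegedyUmans2005
[support] Blocks of a Rees host: for a finite group G with Wedderburn iso ℂ[G] ≃ ∏_i M_(d_i)(ℂ)
(exists_algEquiv_pi_matrix, proved), any n and ANY sandwich P (invertibility not needed), the
contracted structure tensor of M⁰(G;n,n;P) in the semigroup basis restricts from ⊕_i ⟨n·d_i, n·d_i,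
n·d_i⟩: ℂ₀[M⁰] = (M_n(ℂ[G]), X∘Y = X·P̂·Y) and X ↦ X·P̂ is linear, so T_∘ = T_(M_n(ℂ G)) ∘ (·P̂, id,
id); then M_n(∏ M_(d_i)) ≅ ∏ M_(n d_i) and structureTensor_blockBasis_eq_matMulDirectSum. Abelian
case: all d_i = 1 (AddChar diagonalisation, tensorRank_addGroupAlgTensor_le). [difficulty:
provable-now] -/
@[route_item "route-MatrixMultiplication-ReesMunnRealization", crux]
def ReesHostBlocks : Prop :=
  ∀ (G : Type) [Group G] [Fintype G] [DecidableEq G] (n : ℕ) (P : Fin n → Fin n → Option G) (r : ℕ) (d : Fin r → ℕ), (∀ i, NeZero (d i)) → (MonoidAlgebra ℂ G ≃ₐ[ℂ] Literature.RepresentationTheory.FiniteGroups.BlockAlgebraC d) → Literature.Computability.AlgebraicComplexity.TensorRestrictsTo (Literature.Computability.AlgebraicComplexity.matMulDirectSum ℂ (fun i => n * d i) (fun i => n * d i) (fun i => n * d i)) (fun (z x y : Fin n × G × Fin n) => if (P x.2.2 y.1).map (fun p => (x.1, x.2.1 * p * y.2.1, y.2.2)) = some z then (1 : ℂ) else 0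)

/-- item stmt-MatrixMultiplication-4376 · support · rank 9 · closed · proved by Summit.MatrixMultiplication.MatrixMultiplication.Theorems.brandtNoGain_proof @ 5650e60faa7f (prover) · by planner
sources: CohnUmans2003, arXiv:1207.6528, doi:10.1016/j.jcta.2005.08.004
[support] Inverse single-D-class hosts buy nothing (this session's lemma; Morita invariance at the
monomial level): a strict realization of ⟨a,b,e⟩ in the Brandt semigroup B(G,n) = M⁰(G;n,n;Id) has
abe ≤ n³·a'b'e' for some TPP triple (a',b',e') of G (RealizesTPP). Proof: rows/columns are functions
R(i), m(j), C(k); consistency forces φ(i,j) = (R i, s_i τ_j, m j), ψ(j,k) = (m j, τ_j⁻¹ u_k, C k),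
χ(i,k) = (R i, s_i u_k, C k); for each (ρ,μ,γ) the fibre sets (S_ρ,T_μ,U_γ) satisfy the TPP, and abe
= Σ_ρμγ |S_ρ||T_μ||U_γ|. [difficulty: provable-now] -/
@[route_item "route-MatrixMultiplication-ReesMunnRealization"]
def BrandtNoGain : Prop :=
  ∀ (G : Type) [Group G] [Fintype G] [DecidableEq G] (n a b e : ℕ) (φ : Fin a × Fin b → Fin n × G × Fin n) (ψ : Fin b × Fin e → Fin n × G × Fin n) (χ : Fin a × Fin e → Fin n × G × Fin n), (∀ x y z, ((if (φ x).2.2 = (ψ y).1 then some ((φ x).1, (φ x).2.1 * (ψ y).2.1, (ψ y).2.2) else none) = some (χ z) ↔ (z.1 = x.1 ∧ x.2 = y.1 ∧ z.2 = y.2))) → ∃ a' b' e' : ℕ, Literature.Computability.AlgebraicComplexity.RealizesTPP G a' b' e' ∧ a * b * e ≤ n ^ 3 * (a' * b' * e')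

/-- item stmt-MatrixMultiplication-4377 · support · rank 9 · closed · proved by Summit.MatrixMultiplication.MatrixMultiplication.Theorems.AbelianReesGivesTarget_proof @ 95e279b06e10 (prover) · by planner
sources: CohnKleinbergSzegedyUmans2005, Blaser2013
[support] Glue: AbelianReesFamily → BlockRestrictionFamily, via ReesHostBlocks in the abelian case
(p = |G| blocks d ≡ n, so Σ d_i² = |G|n², t·n² ≤ |G|n² from t ≤ |G|), RealizationRestricts and
TensorRestrictsTo.trans; abe ≥ 1 from c·(|G|n²)^(3/2) > 0. [difficulty: provable-now] -/
@[route_item "route-MatrixMultiplication-ReesMunnRealization"]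
def AbelianReesGivesTarget : Prop :=
  AbelianReesFamily → BlockRestrictionFamily

/-- item stmt-MatrixMultiplication-4378 · assembly · rank 1 · closed · proved by Summit.MatrixMultiplication.MatrixMultiplication.Theorems.reesMunnRealization_assembly_proof @ e138801d7933 (prover) · by planner
sources: CohnUmans2003, CohnKleinbergSzegedyUmans2005, Blaser2013
[assembly] BlockRestrictionBound → BlockRestrictionFamily → MatrixMultiplication (the summit
constant, = ω(ℂ) = 2). -/
@[route_item "route-MatrixMultiplication-ReesMunnRealization"]
def Assembly : Prop :=
  BlockRestrictionBound → BlockRestrictionFamily → MatrixMultiplication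

/-! D-0027 §2.1 — DECIDING THEOREM (planner-authored via `route open/edit --closes-file`; by planner-cstrat-stmt-MatrixMultiplication-4368-r1-0 2026-08-17T02:27:00Z):
its hypotheses are this route's items and its conclusion the sub-problem Statement (glue_lint), and it elaborates with this file. -/

/-- DECIDING THEOREM (D-0027 §2.1), re-glued by the crux-strategist's typed decomposition of the
former deciding hypothesis `BlockRestrictionFamily` (X): the design crux `FibreDesignFamily`
(constant-loss strict realizations of `⟨a,b,e⟩` in `P`-twisted fibre tensors over finite groups
with an abelian subgroup `A`, `t·[G:A]² ≤ |G|`), the lift `FibreLift` to the Rees matrix semigroup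
`M⁰(G;n,n;P)`, the block structure `ReesHostBlocks` of the contracted Rees algebra over the
Wedderburn decomposition `ℂ[G] ≃ ∏ M_{dᵢ}(ℂ)` (`exists_algEquiv_pi_matrix`), Cohn–Umans' Prop. 9
`RealizationRestricts` and the degree bound `DegreeLeIndexAbelian` (`dᵢ ≤ [G:A]`) give X with blocks
`n·dᵢ` (`∑(n dᵢ)² = n²|G|`, `t(n dᵢ)² ≤ n²·t[G:A]² ≤ n²|G|`, packing `c(|G|n²)^{3/2} = n²·c·n|G|^{3/2}
≤ n²·abe`); then the Cohn–Umans block inequality `BlockRestrictionBound` decides `ω(ℂ) = 2` by the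
elementary real analysis of the original glue: if `ω > 2` put `η = (ω − 2)/2 > 0`; for the host of
parameter `t`, `D = Σ dᵢ² ≥ 1`, `c^(ω/3)·D^(ω/2) ≤ (abe)^(ω/3) ≤ Σ dᵢ^ω ≤ D·(D/t)^η`, hence
`c^(ω/3) ≤ t^(−η)` for every `t ≥ 1` — absurd. -/
@[closes "route-MatrixMultiplication-ReesMunnRealization"] theorem closes (hB : BlockRestrictionBound) (hH : ReesHostBlocks) (hR : RealizationRestricts)
    (hDeg : DegreeLeIndexAbelian) (hL : FibreLift) (hD : FibreDesignFamily) :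
    MatrixMultiplication := by
  -- Step 1 (the typed decomposition): the pieces give the constant-loss block-restriction family X
  have hX : BlockRestrictionFamily := by
    obtain ⟨c, hc, hfam⟩ := hD
    refine ⟨c, hc, fun t => ?_⟩
    obtain ⟨G, _instG, _instF, A, n, a, b, e, P, φ, ψ, χ, hA, hn, ht, hfib, hpack⟩ := hfam t
    classical
    -- lift the fibre design to a strict realization of `⟨na, b, ne⟩` in `M⁰(G;n,n;P)` (FibreLift)
    obtain ⟨φ', ψ', χ', hreal⟩ := hL G n a b e P φ ψ χ hfib
    -- Wedderburn blocks `ℂ[G] ≃ₐ ∏ᵢ ℂ^{dᵢ×dᵢ}`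
    obtain ⟨r, d, hd, ⟨iso⟩⟩ :=
      Literature.RepresentationTheory.FiniteGroups.exists_algEquiv_pi_matrix G
    haveI : ∀ i, NeZero (d i) := hd
    have hsum : ∑ i, d i ^ 2 = Nat.card G :=
      Literature.RepresentationTheory.FiniteGroups.sum_sq_blockDegrees_eq_card iso
    -- there is at least one block
    have hr : 0 < r := by
      rcases Nat.eq_zero_or_pos r with h0 | h0
      · subst h0
        rw [Fin.sum_univ_zero] at hsum
        exact absurd hsum.symm Nat.card_pos.ne'
      · exact h0
    -- `∑ᵢ (n dᵢ)² = |G| · n²` over `ℝ`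
    have hsumR : ∑ i, (((n * d i : ℕ) : ℝ)) ^ 2 = (Fintype.card G : ℝ) * (n : ℝ) ^ 2 := by
      have h1 : ((∑ i, d i ^ 2 : ℕ) : ℝ) = (Fintype.card G : ℝ) := by
        rw [hsum, Nat.card_eq_fintype_card]
      push_cast at h1
      rw [← h1, Finset.sum_mul]
      exact Finset.sum_congr rfl fun i _ => by push_cast; ring
    -- the host tensor `R_P` restricts from `⊕ᵢ ⟨n dᵢ⟩` (ReesHostBlocks)
    have hhost := hH G n P r d hd iso
    -- `R_P ≥ ⟨na, b, ne⟩` (RealizationRestricts, Cohn–Umans 2013 Prop. 9)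
    have hreal' := hR (Fin n × G × Fin n) (Fin n × G × Fin n) (Fin n × G × Fin n)
      (fun x y => (P x.2.2 y.1).map (fun p => (x.1, x.2.1 * p * y.2.1, y.2.2))) (n * a) b (n * e)
      φ' ψ' χ' hreal
    -- positivity bookkeeping
    have hGpos : (0 : ℝ) < (Fintype.card G : ℝ) := Nat.cast_pos.mpr Fintype.card_pos
    have hnpos : (0 : ℝ) < (n : ℝ) := Nat.cast_pos.mpr hn
    have hpos : (0 : ℝ) < c * ((n : ℝ) * (Fintype.card G : ℝ) ^ ((3 : ℝ) / 2)) :=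
      mul_pos hc (mul_pos hnpos (Real.rpow_pos_of_pos hGpos _))
    have habe : 0 < a * b * e := Nat.cast_pos.mp (hpos.trans_le hpack)
    have ha : 0 < a := Nat.pos_of_ne_zero fun h => by simp [h] at habe
    have hb : 0 < b := Nat.pos_of_ne_zero fun h => by simp [h] at habe
    have he : 0 < e := Nat.pos_of_ne_zero fun h => by simp [h] at habe
    refine ⟨r, fun i => n * d i, n * a, b, n * e, hr, fun i => ?_, ?_, hhost.trans hreal', ?_, ?_⟩
    · -- every block is non-empty: `1 ≤ n dᵢ`
      exact Nat.succ_le_of_lt (Nat.mul_pos hn (Nat.pos_of_ne_zero (NeZero.ne (d i))))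
    · -- `(na) b (ne) ≥ 1`
      exact Nat.succ_le_of_lt (Nat.mul_pos (Nat.mul_pos (Nat.mul_pos hn ha) hb) (Nat.mul_pos hn he))
    · -- packing: `c (|G| n²)^{3/2} = n² · (c · n |G|^{3/2}) ≤ n² · abe = (na) b (ne)`
      simp only [hsumR]
      have hpow : ((Fintype.card G : ℝ) * (n : ℝ) ^ 2) ^ ((3 : ℝ) / 2) =
          (Fintype.card G : ℝ) ^ ((3 : ℝ) / 2) * (n : ℝ) ^ 3 := by
        rw [Real.mul_rpow hGpos.le (sq_nonneg _)]
        congr 1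
        rw [← Real.rpow_natCast _ 2, ← Real.rpow_mul hnpos.le, ← Real.rpow_natCast _ 3]
        norm_num
      calc c * ((Fintype.card G : ℝ) * (n : ℝ) ^ 2) ^ ((3 : ℝ) / 2)
          = (n : ℝ) ^ 2 * (c * ((n : ℝ) * (Fintype.card G : ℝ) ^ ((3 : ℝ) / 2))) := by
            rw [hpow]; ring
        _ ≤ (n : ℝ) ^ 2 * ((a * b * e : ℕ) : ℝ) := mul_le_mul_of_nonneg_left hpack (sq_nonneg _)
        _ = ((n * a * b * (n * e) : ℕ) : ℝ) := by push_cast; ring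
    · -- comparability: `t (n dᵢ)² ≤ n² · t [G:A]² ≤ n² |G| = ∑ⱼ (n dⱼ)²`
      intro i
      simp only [hsumR]
      have hdi : d i ≤ A.index := hDeg G A hA (d i)
        (Literature.RepresentationTheory.FiniteGroups.blockDegree_mem_charDegrees iso i)
      have hnat : t * d i ^ 2 ≤ Fintype.card G :=
        le_trans (Nat.mul_le_mul_left t (Nat.pow_le_pow_left hdi 2)) ht
      have hR' : (t : ℝ) * (d i : ℝ) ^ 2 ≤ (Fintype.card G : ℝ) := by exact_mod_cast hnat
      calc (t : ℝ) * ((n * d i : ℕ) : ℝ) ^ 2 = ((t : ℝ) * (d i : ℝ) ^ 2) * (n : ℝ) ^ 2 := by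
            push_cast; ring
        _ ≤ (Fintype.card G : ℝ) * (n : ℝ) ^ 2 := mul_le_mul_of_nonneg_right hR' (sq_nonneg _)
  -- Step 2 (original glue): BlockRestrictionBound + X decide ω(ℂ) = 2
  rw [MatrixMultiplication_iff]
  refine le_antisymm ?_ (Literature.Computability.AlgebraicComplexity.omega_two_le ℂ)
  by_contra hgt
  rw [not_le] at hgt
  obtain ⟨c, hc, hfam⟩ := hX
  generalize hw : Literature.Computability.AlgebraicComplexity.omega ℂ = w at hgt
  -- `η = (w - 2)/2 > 0`
  have hη : 0 < (w - 2) / 2 := by linarith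
  have hcw : 0 < c ^ (w / 3) := Real.rpow_pos_of_pos hc _
  -- choose `t ≥ 1` with `t^(-η) < c^(w/3)`
  have hlim : Tendsto (fun t : ℕ => (t : ℝ) ^ (-((w - 2) / 2))) atTop (𝓝 0) :=
    (tendsto_rpow_neg_atTop hη).comp tendsto_natCast_atTop_atTop
  obtain ⟨t, ht, ht1⟩ := ((hlim.eventually_lt_const hcw).and (eventually_ge_atTop 1)).exists
  have ht0 : (0 : ℝ) < t := Nat.cast_pos.mpr (Nat.lt_of_lt_of_le Nat.zero_lt_one ht1)
  -- the host at parameter `t`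
  obtain ⟨p, d, a, b, e, hp, hd, habe, hres, hpack, hsmall⟩ := hfam t
  have hbound := hB p d a b e hd hres
  rw [hw] at hbound
  have hdpos : ∀ i, (0 : ℝ) < d i := fun i =>
    Nat.cast_pos.mpr (Nat.lt_of_lt_of_le Nat.zero_lt_one (hd i))
  -- `D = Σ d_i² ≥ 1`
  have hD1 : (1 : ℝ) ≤ ∑ i, (d i : ℝ) ^ 2 := by
    have h' : (1 : ℝ) ≤ d ⟨0, hp⟩ := by exact_mod_cast hd ⟨0, hp⟩
    have h1 : (1 : ℝ) ≤ (d ⟨0, hp⟩ : ℝ) ^ 2 := by nlinarith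
    refine h1.trans ?_
    exact Finset.single_le_sum (f := fun i => (d i : ℝ) ^ 2) (fun i _ => sq_nonneg _)
      (Finset.mem_univ _)
  obtain ⟨D, hD⟩ : ∃ D : ℝ, ∑ i, (d i : ℝ) ^ 2 = D := ⟨_, rfl⟩
  rw [hD] at hpack hsmall hD1
  have hDpos : 0 < D := by linarith
  -- every block is small: `d_i² ≤ D / t`
  have hdi : ∀ i, (d i : ℝ) ^ 2 ≤ D / t := fun i => by
    have := hsmall i
    rw [le_div_iff₀ ht0]
    linarith
  -- upper bound `Σ d_i^w ≤ D · (D/t)^η`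
  have hup : ∑ i, (d i : ℝ) ^ w ≤ D * (D / t) ^ ((w - 2) / 2) := by
    have key : ∀ i, (d i : ℝ) ^ w ≤ (d i : ℝ) ^ 2 * (D / t) ^ ((w - 2) / 2) := by
      intro i
      have hsplit : (d i : ℝ) ^ w = (d i : ℝ) ^ 2 * ((d i : ℝ) ^ 2) ^ ((w - 2) / 2) := by
        rw [← Real.rpow_two, ← Real.rpow_mul (hdpos i).le, ← Real.rpow_add (hdpos i)]
        congr 1
        ring
      rw [hsplit]
      exact mul_le_mul_of_nonneg_left (Real.rpow_le_rpow (sq_nonneg _) (hdi i) hη.le)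
        (sq_nonneg _)
    calc ∑ i, (d i : ℝ) ^ w ≤ ∑ i, (d i : ℝ) ^ 2 * (D / t) ^ ((w - 2) / 2) :=
          Finset.sum_le_sum fun i _ => key i
      _ = D * (D / t) ^ ((w - 2) / 2) := by rw [← Finset.sum_mul, hD]
  -- lower bound `c^(w/3) · D^(w/2) ≤ (abe)^(w/3)`
  have hlow : c ^ (w / 3) * D ^ (w / 2) ≤ ((a * b * e : ℕ) : ℝ) ^ (w / 3) := by
    have h0 : 0 ≤ c * D ^ ((3 : ℝ) / 2) := mul_nonneg hc.le (Real.rpow_nonneg hDpos.le _)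
    have h1 : (c * D ^ ((3 : ℝ) / 2)) ^ (w / 3) ≤ ((a * b * e : ℕ) : ℝ) ^ (w / 3) :=
      Real.rpow_le_rpow h0 hpack (by linarith)
    have h2 : (c * D ^ ((3 : ℝ) / 2)) ^ (w / 3) = c ^ (w / 3) * D ^ (w / 2) := by
      rw [Real.mul_rpow hc.le (Real.rpow_nonneg hDpos.le _), ← Real.rpow_mul hDpos.le,
        show (3 : ℝ) / 2 * (w / 3) = w / 2 by ring]
    rw [← h2]
    exact h1
  -- bookkeeping: `D · (D/t)^η = D^(w/2) · t^(-η)`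
  have h4 : D ^ (w / 2) = D * D ^ ((w - 2) / 2) := by
    rw [show w / 2 = 1 + (w - 2) / 2 by ring, Real.rpow_add hDpos, Real.rpow_one]
  have h3 : D * (D / t) ^ ((w - 2) / 2) = D ^ (w / 2) * (t : ℝ) ^ (-((w - 2) / 2)) := by
    rw [Real.div_rpow hDpos.le ht0.le, Real.rpow_neg ht0.le, h4]
    ring
  have hcomb : c ^ (w / 3) * D ^ (w / 2) ≤ D ^ (w / 2) * (t : ℝ) ^ (-((w - 2) / 2)) := by
    rw [← h3]
    exact hlow.trans (hbound.trans hup)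
  -- cancel `D^(w/2) > 0`: `c^(w/3) ≤ t^(-η)`, contradicting the choice of `t`
  have hDw : 0 < D ^ (w / 2) := Real.rpow_pos_of_pos hDpos _
  have hfin : c ^ (w / 3) ≤ (t : ℝ) ^ (-((w - 2) / 2)) := by
    rw [mul_comm (D ^ (w / 2))] at hcomb
    exact le_of_mul_le_mul_right hcomb hDw
  exact absurd ht (not_lt.2 hfin)

end Summit.MatrixMultiplication.MatrixMultiplication.Theses.ReesMunnRealization
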